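import Mathlib
import Summits.Ventures.PercRepro.TriangleCapRowStair
import Summits.Ventures.PercRepro.TriangleCapRowBands

/-!
# PercRepro — THE LEAF WITNESS: THE ROW WITNESS WITHOUT SPARE RIGHT VERTICES, AND THE ATTAINMENT OF THE SHARP
BAND BOUND ON `n` VERTICES (p3, gen 51; part 244)

The row witness of part 237 with `m = t` (every off-pair ends at a leaf of the star) needs no right vertex beyond
the `r − t` leaves: on `Fin (a + (r − t))` its missing graph `H` is the `(r − t)`-star at `0` plus `t` off-pairs from
the `a − 1` other left vertices to `t` distinct leaves — a triangle-free graph with `r` edges whose star centre `0`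
has exactly `a − 1` non-neighbours.  The structure lemmas of part 237 are re-proved here under the weaker
hypothesis `a + (r − t) ≤ n` (suffix `_leaf`; `rEnd n a t i = a + i`).  With the balanced round-robin left ends
`attach = t` and `offAdjPairs = ℓ q (q − 1) + 2 ρ q`, so (`vertex_band_bottom_attained`) the sharp bound of part 243
is attained: on `ℓ + 1 + (s − t)` vertices (`1 ≤ ℓ`, `2 t ≤ s`) there is a triangle-free graph with `s` edges, a
vertex of degree `s − t`, and `Σ d² + 2 t (s − t − 1) + 2 j = s (s + 1)` with `2 j + 2 q t = t (t − 1) + ℓ q (q + 1)`,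
`q = ⌊t / ℓ⌋`.  Axioms: standard.
-/

namespace PercRepro

namespace TriangleCap

namespace C047

open Finset

/-- `rEnd n a m i < n` for `i < t`, `m = t`, `t + m ≤ r`, `a + (r − t) ≤ n`. -/
theorem rEnd_lt_leaf (n a r t m i : ℕ) (hi : i < t) (hr : t + m ≤ r) (hmt : m = t) (han : a + (r - t) ≤ n) :
    rEnd n a m i < n := by
  unfold rEnd
  split_ifs <;> omega

/-- `a ≤ rEnd n a m i` for `i < t`, `m = t`. -/
theorem le_rEnd_leaf (n a r t m i : ℕ) (hi : i < t) (_hr : t + m ≤ r) (hmt : m = t) (_han : a + (r - t) ≤ n) :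
    a ≤ rEnd n a m i := by
  unfold rEnd
  split_ifs <;> omega

/-- With `m = t` every right end is a leaf. -/
theorem rEnd_lt_iff_leaf (n a r t m i : ℕ) (hi : i < t) (hr : t + m ≤ r) (hmt : m = t) (_han : a + (r - t) ≤ n) :
    rEnd n a m i < a + (r - t) ↔ i < m := by
  unfold rEnd
  split_ifs with h <;> omega

/-- The right ends are distinct. -/
theorem rEnd_inj_leaf (n a r t m i i' : ℕ) (hi : i < t) (hi' : i' < t) (_hr : t + m ≤ r) (hmt : m = t)
    (_han : a + (r - t) ≤ n) (h : rEnd n a m i = rEnd n a m i') : i = i' := by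
  unfold rEnd at h
  split_ifs at h <;> omega


/-- Membership in the `i`-th off-pair (`i < t`). -/
theorem mem_rowPair_iff_leaf (n a r t m : ℕ) (hn : 0 < n) (lf : ℕ → ℕ) (hlf : ∀ i, i < t → 1 ≤ lf i ∧ lf i < a) (i : ℕ)
    (hi : i < t) (hr : t + m ≤ r) (hmt : m = t) (han : a + (r - t) ≤ n) (v : Fin n) :
    v ∈ rowPair n a m hn lf i ↔ v.val = lf i ∨ v.val = rEnd n a m i := by
  unfold rowPair
  rw [Sym2.mem_iff, Fin.ext_iff, Fin.ext_iff, fin'_val n hn _ (by have := hlf i hi; omega),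
    fin'_val n hn _ (rEnd_lt_leaf n a r t m i hi hr hmt han)]

/-- The vertex `0` lies in no off-pair. -/
theorem zero_notMem_rowPair_leaf (n a r t m : ℕ) (hn : 0 < n) (lf : ℕ → ℕ) (hlf : ∀ i, i < t → 1 ≤ lf i ∧ lf i < a)
    (i : ℕ) (hi : i < t) (hr : t + m ≤ r) (hmt : m = t) (han : a + (r - t) ≤ n) : fin' n hn 0 ∉ rowPair n a m hn lf i := by
  rw [mem_rowPair_iff_leaf n a r t m hn lf hlf i hi hr hmt han, fin'_val n hn 0 hn]
  have h1 := hlf i hi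
  have h2 := le_rEnd_leaf n a r t m i hi hr hmt han
  omega

/-- Two off-pairs (`i, i' < t`) agree iff their indices agree. -/
theorem rowPair_eq_iff_leaf (n a r t m : ℕ) (hn : 0 < n) (lf : ℕ → ℕ) (hlf : ∀ i, i < t → 1 ≤ lf i ∧ lf i < a)
    (i i' : ℕ) (hi : i < t) (hi' : i' < t) (hr : t + m ≤ r) (hmt : m = t) (han : a + (r - t) ≤ n) :
    rowPair n a m hn lf i = rowPair n a m hn lf i' ↔ i = i' := by
  constructor
  · intro h
    unfold rowPair at h
    rw [Sym2.eq_iff, Fin.ext_iff, Fin.ext_iff, Fin.ext_iff, Fin.ext_iff,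
      fin'_val n hn _ (by have := hlf i hi; omega), fin'_val n hn _ (rEnd_lt_leaf n a r t m i hi hr hmt han),
      fin'_val n hn _ (by have := hlf i' hi'; omega), fin'_val n hn _ (rEnd_lt_leaf n a r t m i' hi' hr hmt han)] at h
    rcases h with ⟨-, h2⟩ | ⟨h1, -⟩
    · exact rEnd_inj_leaf n a r t m i i' hi hi' hr hmt han h2
    · have := hlf i hi
      have := le_rEnd_leaf n a r t m i' hi' hr hmt han
      omega
  · rintro rfl
    rfl

/-- **`|rowPairs| = t`.** -/
theorem card_rowPairs_leaf (n a r t m : ℕ) (hn : 0 < n) (lf : ℕ → ℕ) (hlf : ∀ i, i < t → 1 ≤ lf i ∧ lf i < a)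
    (hr : t + m ≤ r) (hmt : m = t) (han : a + (r - t) ≤ n) : (rowPairs n a t m hn lf).card = t := by
  unfold rowPairs
  rw [card_image_of_injOn, card_range]
  intro i hi i' hi' h
  simp only [coe_range, Set.mem_Iio] at hi hi'
  exact (rowPair_eq_iff_leaf n a r t m hn lf hlf i i' hi hi' hr hmt han).mp h

/-- An off-pair is a cross pair not at `0`. -/
theorem rowPair_cross_leaf (n a r t m : ℕ) (hn : 0 < n) (lf : ℕ → ℕ) (hlf : ∀ i, i < t → 1 ≤ lf i ∧ lf i < a)
    (hr : t + m ≤ r) (hmt : m = t) (han : a + (r - t) ≤ n) (x y : Fin n) (h : s(x, y) ∈ rowPairs n a t m hn lf) :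
    (1 ≤ x.val ∧ x.val < a ∧ a ≤ y.val) ∨ (1 ≤ y.val ∧ y.val < a ∧ a ≤ x.val) := by
  rw [mem_rowPairs] at h
  obtain ⟨i, hi, he⟩ := h
  unfold rowPair at he
  rw [Sym2.eq_iff, Fin.ext_iff, Fin.ext_iff, Fin.ext_iff, Fin.ext_iff,
    fin'_val n hn _ (by have := hlf i hi; omega), fin'_val n hn _ (rEnd_lt_leaf n a r t m i hi hr hmt han)] at he
  have h1 := hlf i hi
  have h3 := le_rEnd_leaf n a r t m i hi hr hmt han
  rcases he with ⟨hx, hy⟩ | ⟨hx, hy⟩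
  · left; omega
  · right; omega

/-- The neighbourhood of `0` in the missing graph is the star `rightStar n a (r − t)`. -/
theorem filter_adj_missingGraph_rowWitness_leaf (n a r t m : ℕ) (hn : 0 < n) (lf : ℕ → ℕ) (ha : 1 ≤ a)
    (hlf : ∀ i, i < t → 1 ≤ lf i ∧ lf i < a) (hr : t + m ≤ r) (hmt : m = t) (han : a + (r - t) ≤ n) :
    univ.filter (fun v => (missingGraph (rowWitness n a r t m hn lf) (leftPart n a)).Adj (fin' n hn 0) v) =
      rightStar n a (r - t) := by
  ext v
  simp only [mem_filter, mem_univ, true_and, rightStar]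
  by_cases hv : v.val < a
  · rw [missingGraph_adj]
    simp only [leftPart, mem_filter, mem_univ, true_and, fin'_val n hn 0 hn]
    constructor
    · rintro ⟨h, -⟩
      exact absurd hv ((h.mp (by omega)))
    · intro h; omega
  · rw [missingGraph_rowWitness_adj n a r t m hn lf _ v (by rw [fin'_val n hn 0 hn]; omega) (by omega),
      fin'_val n hn 0 hn]
    constructor
    · rintro (⟨-, h⟩ | h)
      · exact ⟨by omega, h⟩
      · exfalso
        rw [mem_rowPairs] at h
        obtain ⟨i, hi, he⟩ := h
        have := zero_notMem_rowPair_leaf n a r t m hn lf hlf i hi hr hmt han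
        rw [he] at this
        exact this (Sym2.mem_mk_left _ _)
    · rintro ⟨-, h⟩
      exact Or.inl ⟨rfl, h⟩

/-- `deg H 0 = r − t` in the missing graph of the row witness. -/
theorem deg_missingGraph_rowWitness_zero_leaf (n a r t m : ℕ) (hn : 0 < n) (lf : ℕ → ℕ) (ha : 1 ≤ a)
    (hlf : ∀ i, i < t → 1 ≤ lf i ∧ lf i < a) (hr : t + m ≤ r) (hmt : m = t) (han : a + (r - t) ≤ n) :
    deg (missingGraph (rowWitness n a r t m hn lf) (leftPart n a)) (fin' n hn 0) = r - t := by
  unfold deg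
  rw [filter_adj_missingGraph_rowWitness_leaf n a r t m hn lf ha hlf hr hmt han, card_rightStar n a (r - t) (by omega)]

/-- The off-edges of `0` in the missing graph are exactly the off-pairs. -/
theorem offEdges_missingGraph_rowWitness_leaf (n a r t m : ℕ) (hn : 0 < n) (lf : ℕ → ℕ) (ha : 1 ≤ a)
    (hlf : ∀ i, i < t → 1 ≤ lf i ∧ lf i < a) (hr : t + m ≤ r) (hmt : m = t) (han : a + (r - t) ≤ n) :
    offEdges (missingGraph (rowWitness n a r t m hn lf) (leftPart n a)) (fin' n hn 0) = rowPairs n a t m hn lf := by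
  ext e
  rw [mem_offEdges, SimpleGraph.mem_edgeFinset]
  refine Sym2.ind (fun x y => ?_) e
  rw [SimpleGraph.mem_edgeSet, Sym2.mem_iff]
  constructor
  · rintro ⟨hadj, h0⟩
    have hcross := (missingGraph_adj _ _ x y).mp hadj
    simp only [leftPart, mem_filter, mem_univ, true_and] at hcross
    have h0x : x.val ≠ 0 := fun h => h0 (Or.inl (Fin.ext (by rw [fin'_val n hn 0 hn]; exact h.symm)))
    have h0y : y.val ≠ 0 := fun h => h0 (Or.inr (Fin.ext (by rw [fin'_val n hn 0 hn]; exact h.symm)))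
    by_cases hx : x.val < a
    · have hy : a ≤ y.val := by
        have := hcross.1.mp hx
        omega
      rcases (missingGraph_rowWitness_adj n a r t m hn lf x y hx hy).mp hadj with ⟨h1, -⟩ | h
      · exact absurd h1 h0x
      · exact h
    · have hy : y.val < a := by
        by_contra hy
        exact hx (hcross.1.mpr hy)
      rcases (missingGraph_rowWitness_adj n a r t m hn lf y x hy (by omega)).mp
        ((missingGraph _ _).adj_symm hadj) with ⟨h1, -⟩ | h
      · exact absurd h1 h0y
      · rw [Sym2.eq_swap]
        exact h
  · intro h
    have hc := rowPair_cross_leaf n a r t m hn lf hlf hr hmt han x y h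
    refine ⟨?_, ?_⟩
    · rcases hc with ⟨h1, h2, h3⟩ | ⟨h1, h2, h3⟩
      · exact (missingGraph_rowWitness_adj n a r t m hn lf x y h2 h3).mpr (Or.inr h)
      · exact (missingGraph _ _).adj_symm
          ((missingGraph_rowWitness_adj n a r t m hn lf y x h2 h3).mpr (Or.inr (by rw [Sym2.eq_swap]; exact h)))
    · rintro (hx | hy)
      · rw [Fin.ext_iff, fin'_val n hn 0 hn] at hx
        omega
      · rw [Fin.ext_iff, fin'_val n hn 0 hn] at hy
        omega

/-- The missing graph has `r` edges. -/
theorem card_edges_missingGraph_rowWitness_leaf (n a r t m : ℕ) (hn : 0 < n) (lf : ℕ → ℕ) (ha : 1 ≤ a)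
    (hlf : ∀ i, i < t → 1 ≤ lf i ∧ lf i < a) (hr : t + m ≤ r) (hmt : m = t) (han : a + (r - t) ≤ n) :
    (missingGraph (rowWitness n a r t m hn lf) (leftPart n a)).edgeFinset.card = r := by
  have h := card_offEdges_add_deg (missingGraph (rowWitness n a r t m hn lf) (leftPart n a)) (fin' n hn 0)
  rw [offEdges_missingGraph_rowWitness_leaf n a r t m hn lf ha hlf hr hmt han, card_rowPairs_leaf n a r t m hn lf hlf hr hmt han,
    deg_missingGraph_rowWitness_zero_leaf n a r t m hn lf ha hlf hr hmt han] at h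
  omega

/-- **`attach = m`** for the row witness. -/
theorem attach_rowWitness_leaf (n a r t m : ℕ) (hn : 0 < n) (lf : ℕ → ℕ) (ha : 1 ≤ a) (hlf : ∀ i, i < t → 1 ≤ lf i ∧ lf i < a)
    (_hm : m ≤ t) (hr : t + m ≤ r) (hmt : m = t) (han : a + (r - t) ≤ n) :
    attach (missingGraph (rowWitness n a r t m hn lf) (leftPart n a)) (fin' n hn 0) = m := by
  have hN := filter_adj_missingGraph_rowWitness_leaf n a r t m hn lf ha hlf hr hmt han
  have hmem : ∀ v, (missingGraph (rowWitness n a r t m hn lf) (leftPart n a)).Adj (fin' n hn 0) v ↔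
      a ≤ v.val ∧ v.val < a + (r - t) := by
    intro v
    rw [Finset.ext_iff] at hN
    have := hN v
    simpa only [mem_filter, mem_univ, true_and, rightStar] using this
  rw [attach_eq_sum_card, offEdges_missingGraph_rowWitness_leaf n a r t m hn lf ha hlf hr hmt han]
  unfold rowPairs
  rw [sum_image (fun i hi i' hi' h => by
    simp only [coe_range, Set.mem_Iio] at hi hi'
    exact (rowPair_eq_iff_leaf n a r t m hn lf hlf i i' hi hi' hr hmt han).mp h)]
  have hterm : ∀ i ∈ range t,
      (univ.filter (fun v => (missingGraph (rowWitness n a r t m hn lf) (leftPart n a)).Adj (fin' n hn 0) v ∧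
        v ∈ rowPair n a m hn lf i)).card = if i < m then 1 else 0 := by
    intro i hi
    rw [mem_range] at hi
    have h1 := hlf i hi
    have h2 := le_rEnd_leaf n a r t m i hi hr hmt han
    have h3 := rEnd_lt_iff_leaf n a r t m i hi hr hmt han
    have h4 := rEnd_lt_leaf n a r t m i hi hr hmt han
    by_cases him : i < m
    · rw [if_pos him]
      have : univ.filter (fun v => (missingGraph (rowWitness n a r t m hn lf) (leftPart n a)).Adj (fin' n hn 0) v ∧
          v ∈ rowPair n a m hn lf i) = {fin' n hn (rEnd n a m i)} := by
        ext v
        simp only [mem_filter, mem_univ, true_and, mem_singleton, hmem,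
          mem_rowPair_iff_leaf n a r t m hn lf hlf i hi hr hmt han, Fin.ext_iff, fin'_val n hn _ h4]
        omega
      rw [this, card_singleton]
    · rw [if_neg him]
      rw [card_eq_zero, filter_eq_empty_iff]
      intro v _
      simp only [hmem, mem_rowPair_iff_leaf n a r t m hn lf hlf i hi hr hmt han]
      omega
  rw [sum_congr rfl hterm, sum_boole, Nat.cast_id]
  have : (range t).filter (fun i => i < m) = range m := by
    ext i
    simp only [mem_filter, mem_range]
    omega
  rw [this, card_range]




/-- **`offAdjPairs = coll t lf`:** two off-pairs share a vertex iff they share their left end. -/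
theorem offAdjPairs_rowWitness_leaf (n a r t m : ℕ) (hn : 0 < n) (lf : ℕ → ℕ) (ha : 1 ≤ a)
    (hlf : ∀ i, i < t → 1 ≤ lf i ∧ lf i < a) (hr : t + m ≤ r) (hmt : m = t) (han : a + (r - t) ≤ n) :
    offAdjPairs (missingGraph (rowWitness n a r t m hn lf) (leftPart n a)) (fin' n hn 0) = coll t lf := by
  unfold offAdjPairs coll
  rw [offEdges_missingGraph_rowWitness_leaf n a r t m hn lf ha hlf hr hmt han]
  unfold rowPairs
  -- the off-diagonal of the image is the image of the off-diagonal under the pair map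
  have hinj : Set.InjOn (rowPair n a m hn lf) ↑(range t) := fun i hi i' hi' h => by
    simp only [coe_range, Set.mem_Iio] at hi hi'
    exact (rowPair_eq_iff_leaf n a r t m hn lf hlf i i' hi hi' hr hmt han).mp h
  have hinj2 : Set.InjOn (Prod.map (rowPair n a m hn lf) (rowPair n a m hn lf)) ↑((range t).offDiag) := by
    intro p hp p' hp' h
    simp only [coe_offDiag, Set.mem_offDiag, coe_range, Set.mem_Iio] at hp hp'
    rw [Prod.ext_iff] at h ⊢
    exact ⟨(rowPair_eq_iff_leaf n a r t m hn lf hlf _ _ hp.1 hp'.1 hr hmt han).mp h.1,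
      (rowPair_eq_iff_leaf n a r t m hn lf hlf _ _ hp.2.1 hp'.2.1 hr hmt han).mp h.2⟩
  rw [offDiag_image_of_injOn hinj, card_filter_image_of_injOn hinj2]
  congr 1
  ext p
  simp only [mem_filter, Prod.map_fst, Prod.map_snd]
  constructor
  · rintro ⟨hp, v, hv1, hv2⟩
    refine ⟨hp, ?_⟩
    rw [mem_offDiag] at hp
    obtain ⟨hp1, hp2, hp12⟩ := hp
    rw [mem_range] at hp1 hp2
    have h1 := hlf p.1 hp1
    have h2 := hlf p.2 hp2
    have h3 := le_rEnd_leaf n a r t m p.1 hp1 hr hmt han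
    have h4 := le_rEnd_leaf n a r t m p.2 hp2 hr hmt han
    rw [mem_rowPair_iff_leaf n a r t m hn lf hlf _ hp1 hr hmt han] at hv1
    rw [mem_rowPair_iff_leaf n a r t m hn lf hlf _ hp2 hr hmt han] at hv2
    rcases hv1 with hv1 | hv1 <;> rcases hv2 with hv2 | hv2
    · omega
    · omega
    · omega
    · exact absurd (rEnd_inj_leaf n a r t m _ _ hp1 hp2 hr hmt han (by omega)) hp12
  · rintro ⟨hp, h⟩
    refine ⟨hp, ?_⟩
    rw [mem_offDiag] at hp
    obtain ⟨hp1, hp2, -⟩ := hp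
    rw [mem_range] at hp1 hp2
    have h1 := hlf p.1 hp1
    refine ⟨fin' n hn (lf p.1), ?_, ?_⟩
    · rw [mem_rowPair_iff_leaf n a r t m hn lf hlf _ hp1 hr hmt han, fin'_val n hn _ (by omega)]
      exact Or.inl rfl
    · rw [mem_rowPair_iff_leaf n a r t m hn lf hlf _ hp2 hr hmt han, fin'_val n hn _ (by omega)]
      exact Or.inl h

/-- **THE SHARP BOUND IS ATTAINED** (`1 ≤ ℓ`, `1 ≤ t`, `2 t ≤ s`, `q = ⌊t / ℓ⌋`): a triangle-free graph on
`ℓ + 1 + (s − t)` vertices with `s` edges, a vertex of degree `s − t` (hence `ℓ` non-neighbours), and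
`Σ d² + 2 t (s − t − 1) + 2 j = s (s + 1)` with `2 j + 2 q t = t (t − 1) + ℓ q (q + 1)`. -/
theorem vertex_band_bottom_attained (ℓ s t : ℕ) (hℓ : 1 ≤ ℓ) (ht : 1 ≤ t) (hs : 2 * t ≤ s) :
    ∃ (H : SimpleGraph (Fin (ℓ + 1 + (s - t)))) (_ : DecidableRel H.Adj) (j : ℕ), H.CliqueFree 3 ∧
      H.edgeFinset.card = s ∧ (∃ w, deg H w + t = s) ∧
      ∑ v, deg H v * deg H v + 2 * (t * (s - t - 1)) + 2 * j = s * (s + 1) ∧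
      2 * j + 2 * (t / ℓ) * t = t * (t - 1) + ℓ * ((t / ℓ) * (t / ℓ + 1)) := by
  have hn0 : 0 < ℓ + 1 + (s - t) := by omega
  have hlf : ∀ i, i < t → 1 ≤ lfRR ℓ 0 i ∧ lfRR ℓ 0 i < ℓ + 1 := fun i _ => by
    have := lfRR_bounds ℓ 0 i hℓ
    omega
  have hr : t + t ≤ s := by omega
  have hmt : t = t := rfl
  have han : ℓ + 1 + (s - t) ≤ ℓ + 1 + (s - t) := le_rfl
  have ha : 1 ≤ ℓ + 1 := by omega
  have hfree : (missingGraph (rowWitness (ℓ + 1 + (s - t)) (ℓ + 1) s t t hn0 (lfRR ℓ 0))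
      (leftPart (ℓ + 1 + (s - t)) (ℓ + 1))).CliqueFree 3 := cliqueFree_of_bipSub _ _ (bipSub_missingGraph _ _)
  have hE := card_edges_missingGraph_rowWitness_leaf (ℓ + 1 + (s - t)) (ℓ + 1) s t t hn0 (lfRR ℓ 0) ha hlf hr hmt han
  have hdeg := deg_missingGraph_rowWitness_zero_leaf (ℓ + 1 + (s - t)) (ℓ + 1) s t t hn0 (lfRR ℓ 0) ha hlf hr hmt han
  have hdec := sum_deg_sq_vertex_decomposition (missingGraph (rowWitness (ℓ + 1 + (s - t)) (ℓ + 1) s t t hn0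
    (lfRR ℓ 0)) (leftPart (ℓ + 1 + (s - t)) (ℓ + 1))) (fin' _ hn0 0)
  rw [hdeg, offEdges_missingGraph_rowWitness_leaf (ℓ + 1 + (s - t)) (ℓ + 1) s t t hn0 (lfRR ℓ 0) ha hlf hr hmt han,
    card_rowPairs_leaf (ℓ + 1 + (s - t)) (ℓ + 1) s t t hn0 (lfRR ℓ 0) hlf hr hmt han,
    attach_rowWitness_leaf (ℓ + 1 + (s - t)) (ℓ + 1) s t t hn0 (lfRR ℓ 0) ha hlf le_rfl hr hmt han,
    offAdjPairs_rowWitness_leaf (ℓ + 1 + (s - t)) (ℓ + 1) s t t hn0 (lfRR ℓ 0) ha hlf hr hmt han,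
    coll_lfRR_zero ℓ t (by omega)] at hdec
  have hthr := row_threshold ℓ t
  obtain ⟨c, hc⟩ := Nat.even_mul_pred_self t
  have hcoll := coll_le t (lfRR ℓ 0)
  rw [coll_lfRR_zero ℓ t (by omega)] at hcoll
  obtain ⟨d, hd⟩ : Even (ℓ * ((t / ℓ) * (t / ℓ - 1)) + 2 * ((t % ℓ) * (t / ℓ))) := by
    apply Even.add
    · exact Even.mul_left (Nat.even_mul_pred_self _) _
    · exact even_two_mul _
  have hdc : d ≤ c := by omega
  refine ⟨_, inferInstance, c - d, hfree, hE, ⟨fin' _ hn0 0, by omega⟩, ?_, by omega⟩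
  have hts : t ≤ s := by omega
  have hts1 : 1 ≤ s - t := by omega
  zify [hts, hts1, hdc, ht] at hdec hc hd ⊢
  linear_combination hdec + hd - hc

end C047

end TriangleCap

end PercRepro
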